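import Literature.AlgebraicGeometry.AbelianSchemes.LevelStructureOfHeckeQuotient
import Literature.AlgebraicGeometry.AbelianSchemes.AbelianSchemeConstSubgroupQuotient
import HarnessLib

/-!
# The constant subgroup of sections indexed by a subgroup of `(ℤ/n)^{2g}` through a level structure

For a commutative abelian scheme `A/S` with a level-`n` structure `φ` (`2g` sections `σᵢ`, [MumfordFogartyKirwan1994,
Ch. 7 §2 Def. 7.1 p. 129]) and an additive subgroup `K₀ ≤ (ℤ/n)^{2g}`, the sections `φ(c) = σ^c`, `c ∈ K₀`, form a finite
subgroup `K ≤ A(S)` — the «constant finite subgroup» of the Hecke quotient `A/K` ([MumfordAV1970, §7 Thm. 4 p. 72];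
[Milne2005ShimuraVarieties, §6 Thm. 6.11 pp. 74–75]).  This file proves the global exponent law `σ^{a+b} = σ^a · σ^b`,
packages `K` as an `∃`-statement together with its enumeration clause `σ ∈ K ↔ ∃ c ∈ K₀, φ(c) = σ` and its finiteness
(no new definition: the socket-(B) glue builds `K` inside a proof), and derives the two clauses the (ii)-chain block asks
of `K`: the torsion clause `hK` (`σ^m = 1` on `K` when `m • K₀ = 0`) and the freeness clause `hfree` (no non-trivial
translation by an element of `K` fixes a geometric point of `A`, from the basis clause `basis_injective` of `φ` and ★
`forall_comp_translation_ne_of_forall_restrict_ne`).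
-/

noncomputable section

universe u

open CategoryTheory CategoryTheory.Limits AlgebraicGeometry MonoidalCategory
open scoped MonObj

namespace Literature.AlgebraicGeometry.AbelianSchemes

namespace AbelianSchemeOver

variable {S : Scheme.{u}} (A : AbelianSchemeOver S) {g n : ℕ}

/-! ## §1 The global exponent law -/

/-- **`σ^{a+b} = σ^a · σ^b`** for `n`-torsion sections `σₖ` of a commutative group scheme (exponent vectors in `(ℤ/n)^{2g}`).
[cite: MumfordFogartyKirwan1994, Ch. 7 §2 Definition 7.1 (p. 129)] -/
theorem sectionPow_add [IsCommMonObj A.X] [NeZero n] {σ : Fin g ⊕ Fin g → A.Sections} (hσ : ∀ k, σ k ^ n = 1) (a b : Fin g ⊕ Fin g → ZMod n) :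
    A.sectionPow σ (a + b) = A.sectionPow σ a * A.sectionPow σ b := by
  rw [A.sectionPow_eq_prod, A.sectionPow_eq_prod, A.sectionPow_eq_prod, ← Finset.prod_mul_distrib]
  refine Finset.prod_congr rfl fun k _ => ?_
  rw [← pow_add, Pi.add_apply, ZMod.val_add, ← pow_eq_pow_mod _ (hσ k)]

/-- **`σ^{-a} = (σ^a)⁻¹`.** [cite: MumfordFogartyKirwan1994, Ch. 7 §2 Definition 7.1 (p. 129)] -/
theorem sectionPow_neg [IsCommMonObj A.X] [NeZero n] {σ : Fin g ⊕ Fin g → A.Sections} (hσ : ∀ k, σ k ^ n = 1) (a : Fin g ⊕ Fin g → ZMod n) :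
    A.sectionPow σ (-a) = (A.sectionPow σ a)⁻¹ := by
  rw [eq_inv_iff_mul_eq_one, ← A.sectionPow_add hσ, neg_add_cancel, sectionPow_zero]

namespace LevelStructure

variable {A} (φ : A.LevelStructure g n)

/-- `φ(a + b) = φ(a) · φ(b)`. [cite: MumfordFogartyKirwan1994, Ch. 7 §2 Definition 7.1 (p. 129)] -/
theorem section_add [IsCommMonObj A.X] [NeZero n] (a b : Fin g ⊕ Fin g → ZMod n) : φ.section_ (a + b) = φ.section_ a * φ.section_ b :=
  A.sectionPow_add φ.pow_σ a b

/-- `φ(0) = 1`. [cite: MumfordFogartyKirwan1994, Ch. 7 §2 Definition 7.1 (p. 129)] -/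
theorem section_zero : φ.section_ (0 : Fin g ⊕ Fin g → ZMod n) = 1 :=
  A.sectionPow_zero φ.σ

/-- `φ(-a) = φ(a)⁻¹`. [cite: MumfordFogartyKirwan1994, Ch. 7 §2 Definition 7.1 (p. 129)] -/
theorem section_neg [IsCommMonObj A.X] [NeZero n] (a : Fin g ⊕ Fin g → ZMod n) : φ.section_ (-a) = (φ.section_ a)⁻¹ :=
  A.sectionPow_neg φ.pow_σ a

/-- **`φ(c)(s̄) = 1` only for `c = 0`** (the basis clause `basis_injective` at the geometric point `s̄`).
[cite: MumfordFogartyKirwan1994, Ch. 7 §2 Definition 7.1 (p. 129)] -/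
theorem eq_zero_of_restrict_section_eq_one {Ω : Type u} [Field Ω] [IsAlgClosed Ω] (s : Spec (.of Ω) ⟶ S)
    {c : Fin g ⊕ Fin g → ZMod n} (h : A.restrict s (φ.section_ c) = 1) : c = 0 := by
  apply φ.basis_injective s
  change A.restrict s (φ.section_ c) = A.restrict s (φ.section_ 0)
  rw [h, section_zero, A.restrict_one]

/-! ## §2 The subgroup `K = φ(K₀)` and its block clauses -/

/-- **THE CONSTANT SUBGROUP OF SECTIONS INDEXED BY `K₀ ≤ (ℤ/n)^{2g}`**: there is a subgroup `K ≤ A(S)` with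
`σ ∈ K ↔ ∃ c ∈ K₀, φ(c) = σ` (packaged as an `∃`; the carrier is the image of `K₀` under `φ`, a subgroup by the exponent
law). [cite: MumfordAV1970, §7 Thm. 4 (p. 72)] [cite: MumfordFogartyKirwan1994, Ch. 7 §2 Definition 7.1 (p. 129)] -/
theorem exists_subgroup_mem_iff [IsCommMonObj A.X] [NeZero n] (K₀ : AddSubgroup (Fin g ⊕ Fin g → ZMod n)) :
    ∃ K : Subgroup A.Sections, ∀ σ : A.Sections, σ ∈ K ↔ ∃ c ∈ K₀, φ.section_ c = σ := by
  refine ⟨{ carrier := {σ | ∃ c ∈ K₀, φ.section_ c = σ}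
            one_mem' := ⟨0, K₀.zero_mem, φ.section_zero⟩
            mul_mem' := ?_
            inv_mem' := ?_ }, fun σ => Iff.rfl⟩
  · rintro _ _ ⟨a, ha, rfl⟩ ⟨b, hb, rfl⟩
    exact ⟨a + b, K₀.add_mem ha hb, φ.section_add a b⟩
  · rintro _ ⟨a, ha, rfl⟩
    exact ⟨-a, K₀.neg_mem ha, φ.section_neg a⟩

/-- `K = φ(K₀)` is finite. [cite: MumfordAV1970, §7 Thm. 4 (p. 72)] -/
theorem finite_of_mem_iff [NeZero n] {K₀ : Set (Fin g ⊕ Fin g → ZMod n)} {K : Subgroup A.Sections}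
    (hK : ∀ σ : A.Sections, σ ∈ K ↔ ∃ c ∈ K₀, φ.section_ c = σ) : Finite K := by
  have hfin : (fun c => φ.section_ c) '' K₀ = (K : Set A.Sections) := by
    ext σ
    exact ⟨fun ⟨c, hc, h⟩ => (hK σ).2 ⟨c, hc, h⟩, fun h => (hK σ).1 h⟩
  have : ((K : Set A.Sections)).Finite := by
    rw [← hfin]
    exact (Set.toFinite K₀).image _
  exact this.to_subtype

/-- **The torsion clause `hK`**: if `m • c = 0` for all `c ∈ K₀` then `σ^m = 1` for all `σ ∈ K = φ(K₀)`.
[cite: MumfordAV1970, §7 Thm. 4 (p. 72)] [cite: MumfordFogartyKirwan1994, Ch. 7 §2 Definition 7.1 (p. 129)] -/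
theorem pow_eq_one_of_mem_iff [IsCommMonObj A.X] [NeZero n] {K₀ : Set (Fin g ⊕ Fin g → ZMod n)} {K : Subgroup A.Sections}
    (hK : ∀ σ : A.Sections, σ ∈ K ↔ ∃ c ∈ K₀, φ.section_ c = σ) {m : ℕ} (hm : ∀ c ∈ K₀, (m : ZMod n) • c = 0) :
    ∀ σ : K, (σ : A.Sections) ^ m = 1 := by
  rintro ⟨σ, hσ⟩
  obtain ⟨c, hc, rfl⟩ := (hK σ).1 hσ
  change φ.section_ c ^ m = 1
  rw [← φ.section_natCast_smul m c, hm c hc, section_zero]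

/-- **The freeness clause, points form**: a section of `K = φ(K₀)` other than `1` restricts to a point other than the
origin in every geometric fibre. [cite: MumfordFogartyKirwan1994, Ch. 7 §2 Definition 7.1 (p. 129)] -/
theorem restrict_ne_of_mem_iff {K₀ : Set (Fin g ⊕ Fin g → ZMod n)} {K : Subgroup A.Sections}
    (hK : ∀ σ : A.Sections, σ ∈ K ↔ ∃ c ∈ K₀, φ.section_ c = σ) :
    ∀ (Ω : Type u) [Field Ω] [IsAlgClosed Ω] (s : Spec (.of Ω) ⟶ S) (σ : A.Sections), σ ∈ K → σ ≠ 1 →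
      A.restrict s σ ≠ A.restrict s 1 := by
  intro Ω _ _ s σ hσ h1 h
  obtain ⟨c, hc, rfl⟩ := (hK σ).1 hσ
  rw [A.restrict_one] at h
  have hc0 : c = 0 := φ.eq_zero_of_restrict_section_eq_one s h
  subst hc0
  exact h1 φ.section_zero

/-- **The freeness clause `hfree` of the (ii)-chain block**: no translation by a section `σ ≠ 1` of `K = φ(K₀)` fixes a
geometric point of `A` (★ `forall_comp_translation_ne_of_forall_restrict_ne`). [cite: SGA1, Exp. V Prop. 2.6 (i), Déf. 2.7]
[cite: MumfordFogartyKirwan1994, Ch. 7 §2 Definition 7.1 (p. 129)] -/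
theorem translation_ne_of_mem_iff {K₀ : Set (Fin g ⊕ Fin g → ZMod n)}
    {K : Subgroup A.Sections} (hK : ∀ σ : A.Sections, σ ∈ K ↔ ∃ c ∈ K₀, φ.section_ c = σ) :
    ∀ (Ω : Type u) [Field Ω] [IsAlgClosed Ω] (x : Spec (.of Ω) ⟶ A.left) (σ : K), σ ≠ 1 →
      x ≫ (A.translation (σ : A.Sections)).left ≠ x :=
  A.forall_comp_translation_ne_of_forall_restrict_ne K (φ.restrict_ne_of_mem_iff hK)

end LevelStructure

end AbelianSchemeOver

end Literature.AlgebraicGeometry.AbelianSchemes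

end
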